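import Summits.ABC.IUTFork.Repair.RHRound4ConstraintRequirementsCDegreeRigidity
import Summits.ABC.IUTFork.Repair.RHRound4ConstraintFacesOdd
import HarnessLib

/-!
# R-H ROUND 4, census row O-14 (sheet V5, PLACE AGGREGATION): degree-type re-weightings are INERT — the composed rider

PROOF-ONLY rider (0 `def` · 0 `instance` · 0 `notation` · 0 new `Prop`; everything BY NAME) on two landed files:
* abc-iut-L5-t8's ★ p547224 `Repair/RHRound4ConstraintRequirementsCDegreeRigidity.lean` — the typed obstruction of ★ p540469 §V5,
  `V5_R1_degreeRigidity K` («a place weight `π` on the places of a number field `K` whose weighted sum of local log-norms kills every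
  principal idele is CONSTANT»), is a THEOREM for every number field: `Round4ConstraintRequirements.V5_R1_degreeRigidity_holds`
  (Dirichlet's unit theorem `unitLattice_span_eq_top` + finiteness of the class group + the product formula, Mathlib by name);
* abc-iut-rh2-q2-eq's ★ p543553 `Repair/RHRound4ConstraintFacesOdd.lean` §V5 — CONSTANT weights are inert: `reweightedMass_const`,
  `reweightedExcess_const`, `reweightedCor312_const_iff`.
The faces' weights live on the bed's place index `T.VQ`, the obstruction's on Mathlib's places `InfinitePlace K ⊕ FinitePlace K`, and NO
dictionary between the two is typed anywhere; the honest composed form therefore quantifies over an ARBITRARY dictionary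
`ι : T.VQ → InfinitePlace K ⊕ FinitePlace K`. RESULTS (all `K`, all `ι`, `π` of degree type, `v₀` any place of `K`):
`π ∘ ι = (π v₀)` constant (`comp_eq_const_of_degree`); the re-weighted mass is `π v₀ · M` and the re-weighted excess is `π v₀ ·` print's
(`reweightedMass_comp_of_degree`, `reweightedExcess_comp_of_degree`); hence the re-weighted requirement `V5_R1_reweightedCor312 P (π ∘ ι)`
is — for `π v₀ > 0` — EQUIVALENT to print's un-weighted one (`reweightedCor312_comp_iff_of_degree`: the re-weighting buys nothing), — for
`π v₀ = 0` — VACUOUSLY TRUE (`reweightedCor312_comp_of_degree_zero`: the zero weighting, a junk corner), — for `π v₀ < 0` — the REVERSED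
inequality `excess ≤ mass` (`reweightedCor312_comp_iff_of_degree_neg`). Census O-14 (R-V5-1): KILLED-BY-CONSISTENCY unconditionally as
typed; residual NONE.
Seat abc-iut-f-193 (GEN 17), row R4V5RIGID of the ROUND-4 census desk (KEY `wake/KEY-abc-iut-f-193-R4V5RIGID.md` e11fb3c4f2b7282b,
abc-iut-rh-lead g6 R96; slimmed to the rider per desk R100 after ★ p547224 landed the obstruction itself — the seat's own 250-line
Mathlib proof of the obstruction, refereed PASS at decl level, is kept in HOME/staging/f/f-193/g17/ as the v1 bytes 165c885fd9202c4c and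
NOT landed, to avoid a type-identical duplicate). Rung LADDER-ABC:A2.RESCUE.H.
HONEST FRAMING: theorems about OUR typed requirement in OUR currency; they say nothing about [IUTchIV] beyond «degree-type place weights are
constant, and constants change nothing»; KILLED = as typed at our interface ≠ refuted in print; no side taken on [IUTchIII] Cor 3.12 /
[IUTchIV] Thm 1.10 / Prop 1.7 or on any author; nothing here asserts that abc is proved or refuted. [claim: Mochizuki2012, status: disputed]
for the bed-currency locutions; the number theory is ★ p547224's. DELIBERATELY NOT HERE: a second proof of the obstruction; any statement
about R-V5-2, R-V5-3, R-V5-4; any typed dictionary `T.VQ → places`.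
-/

noncomputable section

namespace Summit.ABC.IUTFork.Repair.RH.Round4DegreeRigidity

open NumberField Summit.ABC.IUTFork Summit.ABC.IUTFork.Thm311 Summit.ABC.IUTFork.Cor312 Summit.ABC.IUTFork.Cor312.Setting
  Summit.ABC.IUTFork.Repair.RH.SigmaMass Summit.ABC.IUTFork.Repair.RH.Round4ConstraintRequirements
  Summit.ABC.IUTFork.Repair.RH.Round4ConstraintFacesOdd

variable {K : Type*} [Field K] [NumberField K] {T : ThetaIndex} {S : Situation T} (P : Cor312.Setting S)

/-- **Pull-back of a degree-type weight along ANY dictionary is constant.** If `π` kills the weighted log-norm sum of every principal idele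
(the hypothesis of `V5_R1_degreeRigidity`, binders verbatim), then for every `ι : T.VQ → InfinitePlace K ⊕ FinitePlace K` and every place `v₀`,
`π ∘ ι` is the constant weight `π v₀` — ★ p547224 `V5_R1_degreeRigidity_holds` BY NAME. [claim: Mochizuki2012, status: disputed] -/
theorem comp_eq_const_of_degree (π : InfinitePlace K ⊕ FinitePlace K → ℝ)
    (hπ : ∀ x : K, x ≠ 0 →
      (∑ w : InfinitePlace K, π (Sum.inl w) * (w.mult : ℝ) * Real.log (w x)) +
        ∑ᶠ v : FinitePlace K, π (Sum.inr v) * Real.log (v x) = 0)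
    (ι : T.VQ → InfinitePlace K ⊕ FinitePlace K) (v₀ : InfinitePlace K ⊕ FinitePlace K) :
    π ∘ ι = fun _ => π v₀ := by
  obtain ⟨c, hc⟩ := V5_R1_degreeRigidity_holds K π hπ
  funext vQ
  rw [Function.comp_apply, hc (ι vQ), hc v₀]

/-- **Re-weighted MASS under a degree-type weight** = `π v₀ · M` (`reweightedMass_const` ∘ `comp_eq_const_of_degree`; `M = totalTrivialMass P`,
p477034). [claim: Mochizuki2012, status: disputed] -/
theorem reweightedMass_comp_of_degree (π : InfinitePlace K ⊕ FinitePlace K → ℝ)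
    (hπ : ∀ x : K, x ≠ 0 →
      (∑ w : InfinitePlace K, π (Sum.inl w) * (w.mult : ℝ) * Real.log (w x)) +
        ∑ᶠ v : FinitePlace K, π (Sum.inr v) * Real.log (v x) = 0)
    (ι : T.VQ → InfinitePlace K ⊕ FinitePlace K) (v₀ : InfinitePlace K ⊕ FinitePlace K) :
    reweightedMass P (π ∘ ι) = π v₀ * totalTrivialMass P := by
  rw [comp_eq_const_of_degree π hπ ι v₀]
  exact reweightedMass_const P (π v₀)

/-- **Re-weighted EXCESS under a degree-type weight** = `π v₀ ·` print's un-weighted excess (`reweightedExcess_const` ∘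
`comp_eq_const_of_degree`). [claim: Mochizuki2012, status: disputed] -/
theorem reweightedExcess_comp_of_degree (π : InfinitePlace K ⊕ FinitePlace K → ℝ)
    (hπ : ∀ x : K, x ≠ 0 →
      (∑ w : InfinitePlace K, π (Sum.inl w) * (w.mult : ℝ) * Real.log (w x)) +
        ∑ᶠ v : FinitePlace K, π (Sum.inr v) * Real.log (v x) = 0)
    (ι : T.VQ → InfinitePlace K ⊕ FinitePlace K) (v₀ : InfinitePlace K ⊕ FinitePlace K) :
    reweightedExcess P (π ∘ ι) = π v₀ * reweightedExcess P (fun _ => 1) := by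
  rw [comp_eq_const_of_degree π hπ ι v₀]
  exact reweightedExcess_const P (π v₀)

/-- **COROLLARY — DEGREE-TYPE RE-WEIGHTINGS ARE INERT (R-V5-1 kill, UNCONDITIONAL; positive weights).** For a degree-type `π` with
`0 < π v₀` at some place and ANY dictionary `ι`, the re-weighted requirement `V5_R1_reweightedCor312 P (π ∘ ι)` is EQUIVALENT to print's
un-weighted one `V5_R1_reweightedCor312 P (π ≡ 1)` (★ p547224 `V5_R1_degreeRigidity_holds` + ★ p543553 `reweightedCor312_const_iff`, both BY
NAME): the re-weighting buys nothing. [claim: Mochizuki2012, status: disputed] -/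
theorem reweightedCor312_comp_iff_of_degree (π : InfinitePlace K ⊕ FinitePlace K → ℝ)
    (hπ : ∀ x : K, x ≠ 0 →
      (∑ w : InfinitePlace K, π (Sum.inl w) * (w.mult : ℝ) * Real.log (w x)) +
        ∑ᶠ v : FinitePlace K, π (Sum.inr v) * Real.log (v x) = 0)
    (v₀ : InfinitePlace K ⊕ FinitePlace K) (hpos : 0 < π v₀) (ι : T.VQ → InfinitePlace K ⊕ FinitePlace K) :
    V5_R1_reweightedCor312 P (π ∘ ι) ↔ V5_R1_reweightedCor312 P (fun _ => 1) := by
  rw [comp_eq_const_of_degree π hπ ι v₀]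
  exact reweightedCor312_const_iff P hpos

/-- **The zero-weight corner is VACUOUS.** If a degree-type `π` vanishes at some place then it vanishes everywhere, `π ∘ ι ≡ 0`, and the
re-weighted requirement holds trivially (`0·M ≤ 0·excess`) — a junk corner of the typed requirement, recorded so that no census line reads it
as supply. [claim: Mochizuki2012, status: disputed] -/
theorem reweightedCor312_comp_of_degree_zero (π : InfinitePlace K ⊕ FinitePlace K → ℝ)
    (hπ : ∀ x : K, x ≠ 0 →
      (∑ w : InfinitePlace K, π (Sum.inl w) * (w.mult : ℝ) * Real.log (w x)) +
        ∑ᶠ v : FinitePlace K, π (Sum.inr v) * Real.log (v x) = 0)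
    (v₀ : InfinitePlace K ⊕ FinitePlace K) (h0 : π v₀ = 0) (ι : T.VQ → InfinitePlace K ⊕ FinitePlace K) :
    V5_R1_reweightedCor312 P (π ∘ ι) := by
  unfold V5_R1_reweightedCor312
  rw [reweightedMass_comp_of_degree P π hπ ι v₀, reweightedExcess_comp_of_degree P π hπ ι v₀, h0, zero_mul, zero_mul]

/-- **The negative-weight corner REVERSES the inequality.** For a degree-type `π` with `π v₀ < 0` and any dictionary `ι`, the re-weighted
requirement `V5_R1_reweightedCor312 P (π ∘ ι)` (`c·M ≤ c·excess`, `c < 0`) is equivalent to `excess ≤ M` at print's weights — the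
OPPOSITE of what a `π`-theory wants. [claim: Mochizuki2012, status: disputed] -/
theorem reweightedCor312_comp_iff_of_degree_neg (π : InfinitePlace K ⊕ FinitePlace K → ℝ)
    (hπ : ∀ x : K, x ≠ 0 →
      (∑ w : InfinitePlace K, π (Sum.inl w) * (w.mult : ℝ) * Real.log (w x)) +
        ∑ᶠ v : FinitePlace K, π (Sum.inr v) * Real.log (v x) = 0)
    (v₀ : InfinitePlace K ⊕ FinitePlace K) (hneg : π v₀ < 0) (ι : T.VQ → InfinitePlace K ⊕ FinitePlace K) :
    V5_R1_reweightedCor312 P (π ∘ ι) ↔ reweightedExcess P (fun _ => 1) ≤ totalTrivialMass P := by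
  unfold V5_R1_reweightedCor312
  rw [reweightedMass_comp_of_degree P π hπ ι v₀, reweightedExcess_comp_of_degree P π hπ ι v₀]
  exact mul_le_mul_left_of_neg hneg

end Summit.ABC.IUTFork.Repair.RH.Round4DegreeRigidity

end
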